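import Mathlib
import Summits.NavierStokesRegularity.FluidComputer.BorderedEigenpairPairingSections

/-!
# From certified COORDINATES to a POINTWISE lattice eigenfamily, and conjugation symmetry of
# the matrix data — generic glue for the (A5)/(A6) legs of the joint instantiation
(profile-cert-3 g6, cell `ns-blowup`, 2026-08-26)

HONEST FRAMING (human rulings D-0035/D-0074): nothing here is a claim about Navier–Stokes
blow-up. WHAT THIS IS NOT: not NS evidence. MODEL lane bookkeeping about the FORMAT of the F5
certificates (GROUP B `CertificateAbcSpectrum*`; GROUP A X0 chain). No number or word moves.

ARCHITECTURE. The END-TO-END theorems of the bordered chain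
(`BorderedEigenpairFromSections.certified_eigenpair_of_sections_nested`,
`BorderedEigenpairPairingSections.certified_eigenpair_of_sections_nested_of_sections`,
`BorderedEigenpairFromSectionsReal.im_eq_zero_of_certified_clauses`) live on an abstract Hilbert
space with a Hilbert basis `b`; for the model one may take `H = ℓ²(ι)` with its canonical basis,
so that the class-II Craya / orbit-pair basis enters ONLY as a family of lattice families
`v_i : K → E` (`K = ℤ³`, `E = ℂ³`) through finite, pointwise identities. This file supplies the
two remaining generic legs in that pointwise presentation (companion of §3 of
`BorderedEigenpairPairingSections`):

* §1 (A5) CONJUGATION SYMMETRY OF THE DATA: an anti-unitary `J` on `E` (`⟪J x, J y⟫ = conj ⟪x, y⟫`),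
  a bijection `τ` of `K`, families with `v_{σ i} = J ∘ v_i ∘ τ` and an `X` commuting with
  `c ↦ J ∘ c ∘ τ` on them give `a_{σ i, σ j} = conj a_ij` (`hasSum_matrix_conj`); with real
  σ-invariant levels, `conj d_{σ i} = d_i` and `t_{σ i, σ j} = conj t_ij`
  (`conj_symbol_of_levels`, `matrix_conj_of_firstOrder_conj`) — the hypotheses `hd`, `ht` of
  `BorderedEigenpairConjugation.exists_conjugation_of_symmetric_data` /
  `BorderedEigenpairFromSectionsReal`. (Model input: instab4 `AbcLatticeReality.crossForm_conj`.)
* §2 (A6) SYNTHESIS: from the COORDINATE eigen-equation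
  `ℓ_i e_i + Σ_{j ∈ nbr i} a_ij e_j = λ e_i` (the output of
  `BorderedEigenpairFromSectionsCoord.eigen_coord_of_resolventCoord`) to the POINTWISE equation
  `ℓ(k) c(k) + P_k (X c)(k) = λ c(k)` for `c(k) = Σ_{i ∈ I k} e_i v_i(k)` (locally finite families),
  given: `X` local (`(X c)(k)` depends on `c` on a finite `D k`) and linear on finite
  combinations, `P_k` linear on finite combinations, the finite IDENTIFICATION
  `P_k (X v_j)(k) = Σ_{i ∈ col j} a_ij v_i(k)`, band consistency
  (`a_ij ≠ 0 ⇒ i ∈ col j ∧ j ∈ nbr i`) and levels `ℓ_i = ℓ(k)` on `supp v_i` (`pointwise_eigen_of_coord_eigen`) — the hypothesis `hL`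
  of instab4's `AbcLatticeEigenSynthesis.isLinNSEigenvalue_abcFlow_of_certifier_eigen`, up to the
  model's names.
* §3 coefficient recovery for finitely supported orthonormal families (`c ≠ 0` from `e ≠ 0`).
* §4 weighted `ℓ²` transfer: `Σ_i w_i^p |e_i|² < ∞ ⇒ Σ_k w(k)^p ‖c(k)‖² < ∞` for bounded, locally
  finite families with finite fibres (the `RapidDecay` door, all `p`).

Still model-specific: the families `v_i` themselves and the finite identities (definitions lane,
instab3 `CrayaFrames`), the transcribed numbers. Mathlib only; no new definitions.
bears_on LADDER-NS N5 / Z4-a(1)(2); evidence-only for `EpisodeBase`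
(stmt-NavierStokesRegularity-19179). [folklore] throughout.
-/

noncomputable section

namespace Summit.NavierStokesRegularity.FluidComputer.BorderedEigenpairFamilySynthesis

open Filter Topology
open scoped InnerProductSpace ComplexConjugate

variable {𝕜 : Type*} [RCLike 𝕜]
variable {ι K E : Type*}

/-! ## §1 (A5) Conjugation symmetry of the Gram / first-order matrix -/

section Conj

variable [NormedAddCommGroup E] [InnerProductSpace 𝕜 E]

/-- **`a_{σ i, σ j} = conj a_ij`.** If `J` is anti-unitary on `E`, `τ` a bijection of `K`, the
families satisfy `v_{σ i}(k) = J (v_i (τ k))` and `X` commutes with `c ↦ J ∘ c ∘ τ` on the `v_j`,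
then `HasSum (k ↦ ⟪v_i(k), X(v_j)(k)⟫) a ⇒ HasSum (k ↦ ⟪v_{σi}(k), X(v_{σj})(k)⟫) (conj a)`. -/
theorem hasSum_matrix_conj (J : E → E) (hJ : ∀ x y : E, ⟪J x, J y⟫_𝕜 = conj ⟪x, y⟫_𝕜)
    (τ : K ≃ K) (v : ι → K → E) (σ : ι → ι) (hv : ∀ i k, v (σ i) k = J (v i (τ k)))
    (X : (K → E) → (K → E)) (hXJ : ∀ j k, X (fun k => J (v j (τ k))) k = J (X (v j) (τ k)))
    {a : 𝕜} {i j : ι} (ha : HasSum (fun k => ⟪v i k, X (v j) k⟫_𝕜) a) :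
    HasSum (fun k => ⟪v (σ i) k, X (v (σ j)) k⟫_𝕜) (conj a) := by
  have hvj : v (σ j) = fun k => J (v j (τ k)) := funext (hv j)
  have h1 : (fun k => ⟪v (σ i) k, X (v (σ j)) k⟫_𝕜) =
      (fun k => conj ⟪v i k, X (v j) k⟫_𝕜) ∘ τ := by
    funext k
    rw [Function.comp_apply, hv i, hvj, hXJ j k, hJ]
  rw [h1]
  exact τ.hasSum_iff.mpr ((RCLike.hasSum_conj' 𝕜).mpr ha)

end Conj

/-- **`conj d_{σ i} = d_i`** for the free resolvent symbol of real, σ-invariant levels: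
`d_i (x₀ − ℓ_i) = 1`, `ℓ_{σ i} = ℓ_i`. -/
theorem conj_symbol_of_levels (ℓ : ι → ℝ) (x₀ : ℝ) (d : ι → 𝕜)
    (hd : ∀ i, d i * ((x₀ : 𝕜) - (ℓ i : 𝕜)) = 1) (σ : ι → ι) (hℓ : ∀ i, ℓ (σ i) = ℓ i) (i : ι) :
    conj (d (σ i)) = d i := by
  have hdi : ∀ i, d i = ((x₀ : 𝕜) - (ℓ i : 𝕜))⁻¹ := fun i => eq_inv_of_mul_eq_one_left (hd i)
  rw [hdi, hdi, hℓ, map_inv₀, map_sub, RCLike.conj_ofReal, RCLike.conj_ofReal]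

/-- **`t_{σ i, σ j} = conj t_ij`** from `t_ij = a_ij d_j`, `a_{σ i, σ j} = conj a_ij` and
`conj d_{σ j} = d_j` — hypothesis `ht` of
`BorderedEigenpairConjugation.exists_conjugation_of_symmetric_data`. -/
theorem matrix_conj_of_firstOrder_conj (t a : ι → ι → 𝕜) (d : ι → 𝕜)
    (hta : ∀ i j, t i j = a i j * d j) (σ : ι → ι) (ha : ∀ i j, a (σ i) (σ j) = conj (a i j))
    (hdσ : ∀ i, conj (d (σ i)) = d i) (i j : ι) :
    t (σ i) (σ j) = conj (t i j) := by
  rw [hta, hta, ha, map_mul, ← hdσ j, starRingEnd_self_apply]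

/-! ## §2 (A6) Synthesis: coordinate eigen-equation ⇒ pointwise eigen-equation -/

section Synthesis

variable [DecidableEq ι] [AddCommGroup E] [Module 𝕜 E]

omit [DecidableEq ι] in
/-- A locally finite family: on a point `k`, a finite combination over any `F ⊇ I k` equals the
combination over `I k` (indices outside `I k` have `v_i(k) = 0`). -/
theorem sum_smul_eq_of_cover (v : ι → K → E) (I : K → Finset ι)
    (hI : ∀ i k, v i k ≠ 0 → i ∈ I k) (e : ι → 𝕜) (F : Finset ι) (k : K) (hF : I k ⊆ F) :
    ∑ i ∈ F, e i • v i k = ∑ i ∈ I k, e i • v i k := by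
  refine (Finset.sum_subset hF fun i _ hi => ?_).symm
  have h0 : v i k = 0 := by
    by_contra h
    exact hi (hI i k h)
  rw [h0, smul_zero]

/-- **SYNTHESIS OF THE POINTWISE EIGEN-EQUATION.** Families `v_i : K → E`, locally finite
(`v_i(k) ≠ 0 ⇒ i ∈ I k`), with levels `ℓ_i = ℓ(k)` on `supp v_i`; `X` local (through `D k`) and
linear on finite combinations; `P_k` linear on finite combinations; the finite IDENTIFICATION
`P_k (X v_j)(k) = Σ_{i ∈ col j} a_ij v_i(k)` with band consistency
`a_ij ≠ 0 ⇒ i ∈ col j, j ∈ nbr i`. Then the coordinate eigen-equation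
`ℓ_i e_i + Σ_{j ∈ nbr i} a_ij e_j = λ e_i` (all `i`) gives, for `c(k) := Σ_{i ∈ I k} e_i v_i(k)`,
the pointwise equation `ℓ(k) c(k) + P_k (X c)(k) = λ c(k)`. -/
theorem pointwise_eigen_of_coord_eigen
    (v : ι → K → E) (I : K → Finset ι) (hI : ∀ i k, v i k ≠ 0 → i ∈ I k)
    (ℓ : ι → ℝ) (ℓK : K → ℝ) (hℓ : ∀ i k, v i k ≠ 0 → ℓ i = ℓK k)
    (X : (K → E) → (K → E)) (D : K → Finset K)
    (hXloc : ∀ (c c' : K → E) (k : K), (∀ k' ∈ D k, c k' = c' k') → X c k = X c' k)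
    (hX : ∀ (F : Finset ι) (e : ι → 𝕜) (k : K),
      X (fun k => ∑ j ∈ F, e j • v j k) k = ∑ j ∈ F, e j • X (v j) k)
    (P : K → E → E)
    (hP : ∀ (k : K) (F : Finset ι) (g : ι → E) (e : ι → 𝕜),
      P k (∑ j ∈ F, e j • g j) = ∑ j ∈ F, e j • P k (g j))
    (a : ι → ι → 𝕜) (col nbr : ι → Finset ι)
    (hcol : ∀ i j, a i j ≠ 0 → i ∈ col j) (hnbr : ∀ i j, a i j ≠ 0 → j ∈ nbr i)
    (hXv : ∀ j k, P k (X (v j) k) = ∑ i ∈ col j, a i j • v i k)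
    (e : ι → 𝕜) (lam : 𝕜)
    (heq : ∀ i, (ℓ i : 𝕜) * e i + ∑ j ∈ nbr i, a i j * e j = lam * e i) (k : K) :
    ((ℓK k : ℝ) : 𝕜) • (∑ i ∈ I k, e i • v i k) +
        P k (X (fun k => ∑ i ∈ I k, e i • v i k) k) =
      lam • ∑ i ∈ I k, e i • v i k := by
  -- the finite index ranges at `k`
  set Jk : Finset ι := (D k).biUnion I with hJk
  set Jbig : Finset ι := Jk ∪ (I k).biUnion nbr with hJbig
  have hsub : Jk ⊆ Jbig := Finset.subset_union_left
  -- Step A (locality): replace `c` by the finite combination over `Jk`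
  have hA : X (fun k => ∑ i ∈ I k, e i • v i k) k = X (fun k' => ∑ j ∈ Jk, e j • v j k') k := by
    refine hXloc _ _ k fun k' hk' => ?_
    exact (sum_smul_eq_of_cover v I hI e Jk k' (Finset.subset_biUnion_of_mem I hk')).symm
  -- Step B (linearity + identification)
  have hB : P k (X (fun k => ∑ i ∈ I k, e i • v i k) k) =
      ∑ j ∈ Jk, e j • ∑ i ∈ col j, a i j • v i k := by
    rw [hA, hX, hP]
    simp_rw [hXv]
  -- for `j ∉ Jk`, `v_j` vanishes on `D k`, so `P_k (X v_j)(k) = 0`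
  have hX0 : X (fun _ : K => (0 : E)) k = 0 := by simpa using hX ∅ e k
  have hP0 : P k 0 = 0 := by simpa using hP k ∅ (fun _ => (0 : E)) e
  have hvan : ∀ j, j ∉ Jk → ∑ i ∈ col j, a i j • v i k = 0 := by
    intro j hj
    rw [← hXv]
    have h0 : X (v j) k = X (fun _ => 0) k := by
      refine hXloc _ _ k fun k' hk' => ?_
      by_contra h
      exact hj (Finset.mem_biUnion.mpr ⟨k', hk', hI j k' h⟩)
    rw [h0, hX0, hP0]
  -- the `i`-range `col j` may be replaced by `I k`
  have hcolI : ∀ j, ∑ i ∈ col j, a i j • v i k = ∑ i ∈ I k, a i j • v i k := by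
    intro j
    have h1 : ∑ i ∈ col j, a i j • v i k = ∑ i ∈ col j ∪ I k, a i j • v i k :=
      Finset.sum_subset Finset.subset_union_left fun i _ hi => by
        have ha0 : a i j = 0 := by
          by_contra h
          exact hi (hcol i j h)
        rw [ha0, zero_smul]
    have h2 : ∑ i ∈ I k, a i j • v i k = ∑ i ∈ col j ∪ I k, a i j • v i k :=
      Finset.sum_subset Finset.subset_union_right fun i _ hi => by
        have hv0 : v i k = 0 := by
          by_contra h
          exact hi (hI i k h)
        rw [hv0, smul_zero]
    rw [h1, h2]
  -- LEFT side over the big range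
  have hL : P k (X (fun k => ∑ i ∈ I k, e i • v i k) k) =
      ∑ j ∈ Jbig, ∑ i ∈ I k, (e j * a i j) • v i k := by
    rw [hB, Finset.sum_subset hsub (fun j _ hj => by rw [hvan j hj, smul_zero])]
    refine Finset.sum_congr rfl fun j _ => ?_
    rw [hcolI, Finset.smul_sum]
    refine Finset.sum_congr rfl fun i _ => ?_
    rw [smul_smul]
  -- RIGHT side over the big range, by the coordinate equation
  have hR : lam • (∑ i ∈ I k, e i • v i k) - ((ℓK k : ℝ) : 𝕜) • (∑ i ∈ I k, e i • v i k) =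
      ∑ j ∈ Jbig, ∑ i ∈ I k, (e j * a i j) • v i k := by
    rw [Finset.smul_sum, Finset.smul_sum, ← Finset.sum_sub_distrib, Finset.sum_comm]
    refine Finset.sum_congr rfl fun i hi => ?_
    rw [smul_smul, smul_smul, ← sub_smul, ← Finset.sum_smul]
    by_cases hvik : v i k = 0
    · rw [hvik, smul_zero, smul_zero]
    · have hℓi : (ℓ i : 𝕜) = ((ℓK k : ℝ) : 𝕜) := by rw [hℓ i k hvik]
      have hnbrJ : nbr i ⊆ Jbig :=
        (Finset.subset_biUnion_of_mem nbr hi).trans Finset.subset_union_right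
      have hcoef : lam * e i - ((ℓK k : ℝ) : 𝕜) * e i = ∑ j ∈ Jbig, e j * a i j := by
        rw [← hℓi, ← heq i, add_sub_cancel_left,
          Finset.sum_subset hnbrJ (fun j _ hj => by
            have ha0 : a i j = 0 := by
              by_contra h
              exact hj (hnbr i j h)
            rw [ha0, zero_mul])]
        exact Finset.sum_congr rfl fun j _ => mul_comm _ _
      rw [hcoef]
  rw [hL, ← hR]
  abel

end Synthesis

/-! ## §3 Coefficient recovery for finitely supported orthonormal families -/

section Recovery

variable [DecidableEq ι] [NormedAddCommGroup E] [InnerProductSpace 𝕜 E]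

/-- **Coefficient recovery.** Locally finite families (`v_i(k) ≠ 0 ⇒ i ∈ I k`), orthonormal as
FINITE sums over finite sets `S i` (for finitely supported families, `S i ⊇ supp v_i`):
`Σ_{k ∈ S i} ⟪v_i(k), v_{i'}(k)⟫ = δ_{i i'}`. Then the `i`-th coefficient of
`c(k) = Σ_{i' ∈ I k} e_{i'} v_{i'}(k)` is `Σ_{k ∈ S i} ⟪v_i(k), c(k)⟫ = e_i`. -/
theorem sum_inner_synth_eq_coeff (v : ι → K → E) (S : ι → Finset K) (I : K → Finset ι)
    (hI : ∀ i k, v i k ≠ 0 → i ∈ I k)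
    (horth : ∀ i i', ∑ k ∈ S i, ⟪v i k, v i' k⟫_𝕜 = if i = i' then 1 else 0)
    (e : ι → 𝕜) (i : ι) :
    ∑ k ∈ S i, ⟪v i k, ∑ i' ∈ I k, e i' • v i' k⟫_𝕜 = e i := by
  -- enlarge every `I k`, `k ∈ S i`, to the common finite range `F = ⋃_{k ∈ S i} I k`
  set F : Finset ι := (S i).biUnion I with hF
  have hcover : ∀ k ∈ S i, ∑ i' ∈ I k, e i' • v i' k = ∑ i' ∈ F, e i' • v i' k :=
    fun k hk => (sum_smul_eq_of_cover v I hI e F k (Finset.subset_biUnion_of_mem I hk)).symm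
  rw [Finset.sum_congr rfl fun k hk => by rw [hcover k hk]]
  simp_rw [inner_sum, inner_smul_right]
  rw [Finset.sum_comm]
  simp_rw [← Finset.mul_sum, horth]
  by_cases hiF : i ∈ F
  · rw [Finset.sum_eq_single i (fun i' _ hi' => by rw [if_neg (Ne.symm hi'), mul_zero])
      (fun h => (h hiF).elim), if_pos rfl, mul_one]
  · -- impossible: `⟪v_i, v_i⟫ = 1` forces `supp v_i ∩ S i ≠ ∅`, hence `i ∈ F`
    exfalso
    have h1 : ∑ k ∈ S i, ⟪v i k, v i k⟫_𝕜 = 1 := by rw [horth, if_pos rfl]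
    have h0 : ∑ k ∈ S i, ⟪v i k, v i k⟫_𝕜 = 0 := by
      refine Finset.sum_eq_zero fun k hk => ?_
      have : v i k = 0 := by
        by_contra h
        exact hiF (Finset.mem_biUnion.mpr ⟨k, hk, hI i k h⟩)
      rw [this, inner_zero_left]
    exact one_ne_zero (h1.symm.trans h0)

/-- Hence the synthesized family vanishes identically only if every coefficient does. -/
theorem coeff_eq_zero_of_synth_eq_zero (v : ι → K → E) (S : ι → Finset K) (I : K → Finset ι)
    (hI : ∀ i k, v i k ≠ 0 → i ∈ I k)
    (horth : ∀ i i', ∑ k ∈ S i, ⟪v i k, v i' k⟫_𝕜 = if i = i' then 1 else 0)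
    (e : ι → 𝕜) (h0 : ∀ k, ∑ i' ∈ I k, e i' • v i' k = 0) (i : ι) : e i = 0 := by
  rw [← sum_inner_synth_eq_coeff v S I hI horth e i]
  exact Finset.sum_eq_zero fun k _ => by rw [h0 k, inner_zero_right]

end Recovery

/-! ## §4 Weighted `ℓ²` transfer: `H^∞` coefficients ⇒ weighted summability of the family -/

section Weights

variable [NormedAddCommGroup E] [NormedSpace 𝕜 E]

/-- Pointwise bound: `‖Σ_{i∈F} e_i v_i(k)‖² ≤ |F| B² Σ_{i∈F} |e_i|²` when `‖v_i(k)‖ ≤ B`. -/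
theorem norm_sq_sum_smul_le (v : ι → K → E) {B : ℝ} (hB : ∀ i k, ‖v i k‖ ≤ B)
    (e : ι → 𝕜) (F : Finset ι) (k : K) :
    ‖∑ i ∈ F, e i • v i k‖ ^ 2 ≤ (F.card : ℝ) * B ^ 2 * ∑ i ∈ F, ‖e i‖ ^ 2 := by
  have h1 : ‖∑ i ∈ F, e i • v i k‖ ≤ ∑ i ∈ F, ‖e i‖ * B := by
    refine (norm_sum_le _ _).trans (Finset.sum_le_sum fun i _ => ?_)
    rw [norm_smul]
    exact mul_le_mul_of_nonneg_left (hB i k) (norm_nonneg _)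
  have h2 : (∑ i ∈ F, ‖e i‖ * B) ^ 2 ≤ (F.card : ℝ) * ∑ i ∈ F, (‖e i‖ * B) ^ 2 :=
    sq_sum_le_card_mul_sum_sq
  calc ‖∑ i ∈ F, e i • v i k‖ ^ 2 ≤ (∑ i ∈ F, ‖e i‖ * B) ^ 2 :=
        pow_le_pow_left₀ (norm_nonneg _) h1 2
    _ ≤ (F.card : ℝ) * ∑ i ∈ F, (‖e i‖ * B) ^ 2 := h2
    _ = (F.card : ℝ) * B ^ 2 * ∑ i ∈ F, ‖e i‖ ^ 2 := by
        have hsq : ∑ i ∈ F, (‖e i‖ * B) ^ 2 = B ^ 2 * ∑ i ∈ F, ‖e i‖ ^ 2 := by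
          rw [Finset.mul_sum]
          exact Finset.sum_congr rfl fun i _ => by ring
        rw [hsq, mul_assoc]

/-- Double counting over a locally finite cover with finite fibres: for `0 ≤ f` summable,
`|{k : i ∈ I k}| ≤ |S i| ≤ M` ⇒ `k ↦ Σ_{i ∈ I k} f i` is summable. -/
theorem summable_sum_cover (I : K → Finset ι) (S : ι → Finset K)
    (hS : ∀ i k, i ∈ I k → k ∈ S i) {M : ℕ} (hM : ∀ i, (S i).card ≤ M)
    (f : ι → ℝ) (hf0 : ∀ i, 0 ≤ f i) (hf : Summable f) :
    Summable fun k => ∑ i ∈ I k, f i := by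
  classical
  refine summable_of_sum_le (c := M * ∑' i, f i) (fun k => Finset.sum_nonneg fun i _ => hf0 i)
    fun F => ?_
  rw [Finset.sum_comm' (t' := F.biUnion I) (s' := fun i => F.filter fun k => i ∈ I k)
    (fun k i => by
      simp only [Finset.mem_filter, Finset.mem_biUnion]
      exact ⟨fun h => ⟨⟨h.1, h.2⟩, k, h.1, h.2⟩, fun h => ⟨h.1.1, h.1.2⟩⟩)]
  calc ∑ i ∈ F.biUnion I, ∑ _k ∈ F.filter (fun k => i ∈ I k), f i
      = ∑ i ∈ F.biUnion I, ((F.filter fun k => i ∈ I k).card : ℝ) * f i :=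
        Finset.sum_congr rfl fun i _ => by rw [Finset.sum_const, nsmul_eq_mul]
    _ ≤ ∑ i ∈ F.biUnion I, (M : ℝ) * f i := by
        refine Finset.sum_le_sum fun i _ => mul_le_mul_of_nonneg_right ?_ (hf0 i)
        have hsub : (F.filter fun k => i ∈ I k) ⊆ S i := fun k hk =>
          hS i k (Finset.mem_filter.mp hk).2
        exact_mod_cast (Finset.card_le_card hsub).trans (hM i)
    _ = M * ∑ i ∈ F.biUnion I, f i := by rw [Finset.mul_sum]
    _ ≤ M * ∑' i, f i :=
        mul_le_mul_of_nonneg_left (hf.sum_le_tsum _ fun i _ => hf0 i) (Nat.cast_nonneg M)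

/-- **Weighted `ℓ²` transfer.** Locally finite cover with `|I k| ≤ N`, finite fibres
`{k : i ∈ I k} ⊆ S i`, `|S i| ≤ M`, `‖v_i(k)‖ ≤ B`, weights `0 ≤ wK(k) ≤ w_i` whenever `i ∈ I k`
(shells: `=`) and `0 ≤ w_i`:
`Σ_i w_i^p |e_i|² < ∞ ⇒ Σ_k wK(k)^p ‖Σ_{i∈I k} e_i v_i(k)‖² < ∞`. For all `p` at once: `H^∞`
coefficients (`BorderedEigenpairFromSectionsCoord.summable_weights_of_resolventCoord`) give a
rapidly decaying synthesized family (the `RapidDecay` door of `AbcLatticeEigenSynthesis`). -/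
theorem summable_weight_norm_sq_synth (v : ι → K → E) (I : K → Finset ι) (S : ι → Finset K)
    (hS : ∀ i k, i ∈ I k → k ∈ S i) {N M : ℕ} (hN : ∀ k, (I k).card ≤ N)
    (hM : ∀ i, (S i).card ≤ M) {B : ℝ} (hB : ∀ i k, ‖v i k‖ ≤ B)
    (w : ι → ℝ) (hw0 : ∀ i, 0 ≤ w i) (wK : K → ℝ) (hwK0 : ∀ k, 0 ≤ wK k)
    (hw : ∀ i k, i ∈ I k → wK k ≤ w i) (e : ι → 𝕜) (p : ℕ)
    (he : Summable fun i => w i ^ p * ‖e i‖ ^ 2) :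
    Summable fun k => wK k ^ p * ‖∑ i ∈ I k, e i • v i k‖ ^ 2 := by
  have hf0 : ∀ i, 0 ≤ w i ^ p * ‖e i‖ ^ 2 := fun i =>
    mul_nonneg (pow_nonneg (hw0 i) p) (sq_nonneg _)
  have hg := (summable_sum_cover I S hS hM _ hf0 he).mul_left ((N : ℝ) * B ^ 2)
  refine Summable.of_nonneg_of_le (fun k => mul_nonneg (pow_nonneg (hwK0 k) p) (sq_nonneg _))
    (fun k => ?_) hg
  have hsum0 : 0 ≤ ∑ i ∈ I k, ‖e i‖ ^ 2 := Finset.sum_nonneg fun i _ => sq_nonneg _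
  have hcard : ((I k).card : ℝ) * B ^ 2 * ∑ i ∈ I k, ‖e i‖ ^ 2 ≤
      (N : ℝ) * B ^ 2 * ∑ i ∈ I k, ‖e i‖ ^ 2 :=
    mul_le_mul_of_nonneg_right (mul_le_mul_of_nonneg_right (by exact_mod_cast hN k) (sq_nonneg B))
      hsum0
  calc wK k ^ p * ‖∑ i ∈ I k, e i • v i k‖ ^ 2
      ≤ wK k ^ p * ((N : ℝ) * B ^ 2 * ∑ i ∈ I k, ‖e i‖ ^ 2) :=
        mul_le_mul_of_nonneg_left ((norm_sq_sum_smul_le v hB e (I k) k).trans hcard)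
          (pow_nonneg (hwK0 k) p)
    _ = (N : ℝ) * B ^ 2 * ∑ i ∈ I k, wK k ^ p * ‖e i‖ ^ 2 := by
        have hms : ∑ i ∈ I k, wK k ^ p * ‖e i‖ ^ 2 = wK k ^ p * ∑ i ∈ I k, ‖e i‖ ^ 2 := by
          rw [Finset.mul_sum]
        rw [hms]
        ring
    _ ≤ (N : ℝ) * B ^ 2 * ∑ i ∈ I k, w i ^ p * ‖e i‖ ^ 2 := by
        refine mul_le_mul_of_nonneg_left (Finset.sum_le_sum fun i hi => ?_) (by positivity)
        exact mul_le_mul_of_nonneg_right (pow_le_pow_left₀ (hwK0 k) (hw i k hi) p) (sq_nonneg _)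

end Weights

end Summit.NavierStokesRegularity.FluidComputer.BorderedEigenpairFamilySynthesis

end
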